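import Mathlib
import Summits.AnomalousDissipation.AnomalousDissipation.Theses.DyadicWallCascade
import Literature.Uncategorized.SteadyNSRealAnalytic

/-!
# `¬ DyadicWallCascade.WallProfileExists` modulo real-analyticity of steady Navier–Stokes flows
# (negative lemma for the crux `DyadicRealisation`, stmt-AnomalousDissipation-18630)

Refuter file, Negative lane (D-0016), route `DyadicWallCascade` of `Summits/AnomalousDissipation`.

The crux `DyadicRealisation` (item stmt-AnomalousDissipation-18630) is, by `rfl`, the implication
`WallProfileExists → CoherentStates.SteadyZerothLaw`; its antecedent is the route's support statement
`WallProfileExists` (stmt-AnomalousDissipation-18628), also the conclusion of the crux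
`ViscousContinuation` (stmt-AnomalousDissipation-18629).  This file proves

  `WallProfileExists_false_of_SteadyNSRealAnalytic : Literature.Uncategorized.SteadyNSRealAnalytic → ¬ WallProfileExists`,

where `SteadyNSRealAnalytic` (H) is the classical theorem — not yet in the tree — that smooth entire
solutions of the stationary Navier–Stokes system are real-analytic (Morrey 1958, analyticity for
analytic non-linear elliptic systems, applied to the ADN-elliptic stationary Navier–Stokes system;
Kahane 1969 for Navier–Stokes specifically).  Consequences (recorded as item evidence, not here):
modulo H the crux `DyadicRealisation` is VACUOUSLY true, `ViscousContinuation ↔ ¬ HalfSpaceHierarchy`,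
and the route's mechanism object (one exact force-free viscous wall profile, 1-periodic near the wall
and `2^j`-periodic on the dyadic band `2^j ≤ |z| ≤ 2^(j+1)`, blowing down to a hierarchy with non-zero
energy flux) does not exist.

## The argument (all steps kernel-checked below)

1. `periodic_of_analytic_of_slab`: `W` is `e₀`- and `e₁`-periodic on the slab `|X₂| ≤ 1` (a clause of
   `WallProfileExists`); `X ↦ W (X + eᵢ) - W X` is real-analytic on `ℝ³` (H) and vanishes on the open
   slab, hence everywhere (identity principle, `AnalyticOnNhd.eq_of_eventuallyEq`): the prescribed
   dyadic coarsening of the horizontal period with height is impossible — `W` has period `1` at every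
   height.
2. `blowdown_periodic`: the blow-downs `W (2^m • ·)` are `2^{-m}`-periodic, so their uniform limit `V`
   on the band `1 ≤ X₂ ≤ 2` has every period `(2^k)⁻¹ • eᵢ`.
3. `fderiv_apply_eq_zero_of_dyadic_periods`, `const_on_line`: `V` is `C^∞` on the open half-space,
   so difference quotients along `(2^k)⁻¹ eᵢ → 0` give `∂ᵢ V = 0` (`i = 0, 1`) on the band, and `V` is
   constant on horizontal lines there; in particular the trace `q ↦ V (q₁, q₂, 1)` is a constant `c`.
4. The zero-mass-flux clause `∫_{[0,1]²} V₂(q,1) dq = 0` gives `c₂ = 0`, so the energy-flux integrand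
   `V₂ (|V|²/2 + Q)` vanishes on the plane and the energy-flux clause gives `F = 0`, contradicting the
   clause `F ≠ 0`.

Only the slab periodicity of `W`, H, the blow-down clause, smoothness of `V` on the half-space and
the two flux clauses are used — no Euler/Navier–Stokes structure of `V`, no dilation invariance, no
mirror symmetry.  Hence no cheap repair of the antecedent keeps the mechanism: ANY exact entire
steady Navier–Stokes profile that is horizontally periodic on some open set blows down to a
horizontally constant field, whose energy flux through the wall-parallel planes is carried by the
mean mass flux only.

## References

* [Morrey1958] C. B. Morrey, *On the analyticity of the solutions of analytic non-linear elliptic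
  systems of partial differential equations. Part I. Analyticity in the interior*, Amer. J. Math. 80
  (1958) 198–218 (doi:10.2307/2372830); Part II, ibid. 219–237.
* [Kahane1969] C. Kahane, *On the spatial analyticity of solutions of the Navier–Stokes equations*,
  Arch. Rational Mech. Anal. 33 (1969) 386–405 (doi:10.1007/bf00247697; acquisition acq-04631).
* [Masuda1967] K. Masuda, Proc. Japan Acad. 43 (1967) 827–832 (doi:10.3792/pja/1195521421), Thms. 1–2
  (analyticity and unique continuation, time-dependent problem with adherence; read).
-/

open scoped BigOperators Topology
open Filter Set MeasureTheory

-- `Summit.<Summit>.<Problem>` is the tree's mandated summit-side namespace (CONVENTIONS §2); for this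
-- single-conjunct summit the two coincide, so the duplicate is deliberate.
set_option linter.dupNamespace false

namespace Summit.AnomalousDissipation.AnomalousDissipation.Theorems

namespace DyadicWallCascadeNegative

/-- Step 1: an entire real-analytic field that is `v`-periodic on the open slab `|X₂| < 1`
is `v`-periodic everywhere (identity principle for real-analytic maps on the connected space `ℝ³`).
[folklore] -/
theorem periodic_of_analytic_of_slab {W : EuclideanSpace ℝ (Fin 3) → EuclideanSpace ℝ (Fin 3)}
    (hW : AnalyticOnNhd ℝ W Set.univ) (v : EuclideanSpace ℝ (Fin 3))
    (hv : ∀ X : EuclideanSpace ℝ (Fin 3), |X 2| ≤ 1 → W (X + v) = W X) :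
    ∀ X, W (X + v) = W X := by
  have hin : ∀ X : EuclideanSpace ℝ (Fin 3),
      AnalyticAt ℝ (fun Y : EuclideanSpace ℝ (Fin 3) => Y + v) X := fun X =>
    analyticAt_id.add analyticAt_const
  have h1 : AnalyticOnNhd ℝ (fun X => W (X + v)) Set.univ := fun X _ =>
    (hW (X + v) trivial).comp (f := fun Y : EuclideanSpace ℝ (Fin 3) => Y + v) (hin X)
  have h2 : (fun X => W (X + v)) =ᶠ[𝓝 (0 : EuclideanSpace ℝ (Fin 3))] W := by
    have hopen : IsOpen {X : EuclideanSpace ℝ (Fin 3) | |X 2| < 1} := by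
      have hc : Continuous fun X : EuclideanSpace ℝ (Fin 3) => |X 2| :=
        (continuous_abs.comp (PiLp.continuous_apply 2 (fun _ : Fin 3 => ℝ) (2 : Fin 3)))
      exact isOpen_lt hc continuous_const
    have hmem : (0 : EuclideanSpace ℝ (Fin 3)) ∈ {X : EuclideanSpace ℝ (Fin 3) | |X 2| < 1} := by
      simp
    filter_upwards [hopen.mem_nhds hmem] with X hX
    exact hv X (le_of_lt hX)
  have h3 := AnalyticOnNhd.eq_of_eventuallyEq h1 hW h2
  intro X
  exact congrFun h3 X

/-- Step 2: a period iterates to all its natural multiples. [folklore] -/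
theorem periodic_nat_mul {W : EuclideanSpace ℝ (Fin 3) → EuclideanSpace ℝ (Fin 3)}
    (v : EuclideanSpace ℝ (Fin 3)) (hv : ∀ X, W (X + v) = W X) :
    ∀ (n : ℕ) (X), W (X + (n : ℝ) • v) = W X := by
  intro n
  induction n with
  | zero => intro X; simp
  | succ n ih =>
    intro X
    have : X + ((n + 1 : ℕ) : ℝ) • v = (X + (n : ℝ) • v) + v := by
      rw [Nat.cast_succ, add_smul, one_smul, add_assoc]
    rw [this, hv, ih]


/-- Step 3: a uniform blow-down limit on the band `1 ≤ X₂ ≤ 2` of a field with horizontal period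
`v` inherits every period `(2^k)⁻¹ • v`. [folklore] -/
theorem blowdown_periodic {W V : EuclideanSpace ℝ (Fin 3) → EuclideanSpace ℝ (Fin 3)}
    {v : EuclideanSpace ℝ (Fin 3)} (hv2 : v 2 = 0)
    (hP : ∀ (n : ℕ) (X), W (X + (n : ℝ) • v) = W X)
    (hbd : ∀ ε : ℝ, 0 < ε → ∃ M : ℕ, ∀ m : ℕ, M ≤ m → ∀ X : EuclideanSpace ℝ (Fin 3),
      1 ≤ X 2 → X 2 ≤ 2 → ‖W ((2 : ℝ) ^ m • X) - V X‖ ≤ ε)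
    (k : ℕ) (X : EuclideanSpace ℝ (Fin 3)) (h1 : 1 ≤ X 2) (h2 : X 2 ≤ 2) :
    V (X + ((2 : ℝ) ^ k)⁻¹ • v) = V X := by
  refine eq_of_forall_dist_le fun ε hε => ?_
  obtain ⟨M, hM⟩ := hbd (ε / 2) (by positivity)
  have hc : ∀ c : ℝ, (X + c • v) 2 = X 2 := by intro c; simp [hv2]
  have hkm : k ≤ max M k := le_max_right _ _
  have hA := hM (max M k) (le_max_left _ _) (X + ((2 : ℝ) ^ k)⁻¹ • v) (by rw [hc]; exact h1)
    (by rw [hc]; exact h2)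
  have hB := hM (max M k) (le_max_left _ _) X h1 h2
  have key : W ((2 : ℝ) ^ (max M k) • (X + ((2 : ℝ) ^ k)⁻¹ • v)) = W ((2 : ℝ) ^ (max M k) • X) := by
    have h2k : (2 : ℝ) ^ (max M k) * ((2 : ℝ) ^ k)⁻¹ = ((2 ^ (max M k - k) : ℕ) : ℝ) := by
      rw [Nat.cast_pow, Nat.cast_ofNat, pow_sub₀ _ two_ne_zero hkm]
    rw [smul_add, smul_smul, h2k, hP]
  rw [key] at hA
  calc dist (V (X + ((2 : ℝ) ^ k)⁻¹ • v)) (V X)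
      ≤ dist (V (X + ((2 : ℝ) ^ k)⁻¹ • v)) (W ((2 : ℝ) ^ (max M k) • X))
        + dist (W ((2 : ℝ) ^ (max M k) • X)) (V X) := dist_triangle _ _ _
    _ ≤ ε / 2 + ε / 2 := by
        gcongr
        · rw [dist_comm, dist_eq_norm]; exact hA
        · rw [dist_eq_norm]; exact hB
    _ = ε := by ring

/-- Step 4: a field differentiable at `Y` with the periods `(2^k)⁻¹ • v` at `Y` has zero derivative
along `v` there (the difference quotients along `(2^k)⁻¹ v → 0` vanish; `HasFDerivAt.lim`).
[folklore] -/
theorem fderiv_apply_eq_zero_of_dyadic_periods {V : EuclideanSpace ℝ (Fin 3) → EuclideanSpace ℝ (Fin 3)}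
    {Y v : EuclideanSpace ℝ (Fin 3)} (hd : DifferentiableAt ℝ V Y)
    (hper : ∀ k : ℕ, V (Y + ((2 : ℝ) ^ k)⁻¹ • v) = V Y) : fderiv ℝ V Y v = 0 := by
  have hc : Tendsto (fun n : ℕ => ‖(2 : ℝ) ^ n‖) atTop atTop := by
    simpa using tendsto_pow_atTop_atTop_of_one_lt (one_lt_two : (1 : ℝ) < 2)
  have hlim := hd.hasFDerivAt.lim v hc
  have hzero : (fun n : ℕ => (2 : ℝ) ^ n • (V (Y + ((2 : ℝ) ^ n)⁻¹ • v) - V Y)) = fun _ => 0 := by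
    funext n; rw [hper n, sub_self, smul_zero]
  rw [hzero] at hlim
  exact (tendsto_nhds_unique tendsto_const_nhds hlim).symm

/-- Step 5: with steps 3–4 along the whole horizontal line through a band point, the limit field is
constant on that line (`is_const_of_deriv_eq_zero`). [folklore] -/
theorem const_on_line {W V : EuclideanSpace ℝ (Fin 3) → EuclideanSpace ℝ (Fin 3)}
    {v : EuclideanSpace ℝ (Fin 3)} (hv2 : v 2 = 0)
    (hP : ∀ (n : ℕ) (X), W (X + (n : ℝ) • v) = W X)
    (hbd : ∀ ε : ℝ, 0 < ε → ∃ M : ℕ, ∀ m : ℕ, M ≤ m → ∀ X : EuclideanSpace ℝ (Fin 3),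
      1 ≤ X 2 → X 2 ≤ 2 → ‖W ((2 : ℝ) ^ m • X) - V X‖ ≤ ε)
    (hVd : ∀ X : EuclideanSpace ℝ (Fin 3), 0 < X 2 → DifferentiableAt ℝ V X)
    (B : EuclideanSpace ℝ (Fin 3)) (hB1 : 1 ≤ B 2) (hB2 : B 2 ≤ 2) (t : ℝ) :
    V (B + t • v) = V B := by
  have hc : ∀ c : ℝ, (B + c • v) 2 = B 2 := by intro c; simp [hv2]
  have hpos : ∀ c : ℝ, 0 < (B + c • v) 2 := fun c => by rw [hc]; linarith
  have hD : ∀ s : ℝ, HasDerivAt (fun r : ℝ => V (B + r • v)) (fderiv ℝ V (B + s • v) v) s := by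
    intro s
    have hℓ : HasDerivAt (fun r : ℝ => B + r • v) v s := by
      simpa using ((hasDerivAt_id s).smul_const v).const_add B
    exact (hVd _ (hpos s)).hasFDerivAt.comp_hasDerivAt s hℓ
  have h0 : ∀ s : ℝ, fderiv ℝ V (B + s • v) v = 0 := fun s =>
    fderiv_apply_eq_zero_of_dyadic_periods (hVd _ (hpos s)) fun k =>
      blowdown_periodic hv2 hP hbd k (B + s • v) (by rw [hc]; exact hB1) (by rw [hc]; exact hB2)
  have hdiff : Differentiable ℝ (fun r : ℝ => V (B + r • v)) := fun s => (hD s).differentiableAt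
  have hder : ∀ s, deriv (fun r : ℝ => V (B + r • v)) s = 0 := fun s => by
    rw [(hD s).deriv, h0 s]
  have := is_const_of_deriv_eq_zero hdiff hder t 0
  simpa using this

end DyadicWallCascadeNegative

open DyadicWallCascadeNegative in
/-- **`SteadyNSRealAnalytic → ¬ WallProfileExists`** (negative lemma modulo H for route
`DyadicWallCascade`: support stmt-AnomalousDissipation-18628 is false, crux
stmt-AnomalousDissipation-18630 `DyadicRealisation = (WallProfileExists → SteadyZerothLaw)` is
vacuous, crux stmt-AnomalousDissipation-18629 `ViscousContinuation` collapses to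
`¬ HalfSpaceHierarchy`).  Witness mechanism: analyticity propagates the unit horizontal period of the
viscous cap from the slab `|z| ≤ 1` to all heights, so the blow-down hierarchy `V` is horizontally
constant on the band `1 ≤ z ≤ 2`; zero mass flux then kills the vertical trace `V₂` on `z = 1` and
with it the energy flux `F`, contradicting `F ≠ 0`.  Classification (for the planner's repair mode):
for the crux 18630 this is `misstated: vacuous antecedent`; for the route it is substantive — no
clause-level repair of `WallProfileExists` survives (see the module docstring). [folklore] -/
theorem WallProfileExists_false_of_SteadyNSRealAnalytic (hA : Literature.Uncategorized.SteadyNSRealAnalytic) :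
    ¬ Summit.AnomalousDissipation.AnomalousDissipation.Theses.DyadicWallCascade.WallProfileExists := by
  rintro ⟨W, P, V, Q, C, F, C', hh⟩
  simp only at hh
  obtain ⟨⟨hVs, hQs, hbdd, hdiv, hEul, hdil, hper, hmass, hF, hflux⟩, hWs, hPs, hWb, hmir, hWdiv,
    hNS, hW1, hWj, hbd⟩ := hh
  have hWan : AnalyticOnNhd ℝ W Set.univ := hA W P hWs hPs hWdiv hNS
  have hP0 : ∀ X, W (X + EuclideanSpace.single 0 1) = W X :=
    periodic_of_analytic_of_slab hWan _ (fun X hX => (hW1 X hX).1)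
  have hP1 : ∀ X, W (X + EuclideanSpace.single 1 1) = W X :=
    periodic_of_analytic_of_slab hWan _ (fun X hX => (hW1 X hX).2)
  -- `V` is differentiable on the open upper half-space
  have hHopen : IsOpen {X : EuclideanSpace ℝ (Fin 3) | 0 < X 2} :=
    isOpen_lt continuous_const (PiLp.continuous_apply 2 (fun _ : Fin 3 => ℝ) (2 : Fin 3))
  have hVd : ∀ X : EuclideanSpace ℝ (Fin 3), 0 < X 2 → DifferentiableAt ℝ V X := fun X hX =>
    (hVs.differentiableOn (by simp) X hX).differentiableAt (hHopen.mem_nhds hX)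
  -- the trace of `V` on the plane `X₂ = 1` is constant
  have he0 : (EuclideanSpace.single (0 : Fin 3) (1 : ℝ)) 2 = 0 := by simp
  have he1 : (EuclideanSpace.single (1 : Fin 3) (1 : ℝ)) 2 = 0 := by simp
  have hpt2 : ∀ a b : ℝ, (!₂[a, b, (1 : ℝ)]) 2 = 1 := by intro a b; simp
  have hline0 : ∀ a b : ℝ,
      !₂[a, b, (1 : ℝ)] = !₂[(0 : ℝ), b, (1 : ℝ)] + a • EuclideanSpace.single (0 : Fin 3) (1 : ℝ) := by
    intro a b; ext i; fin_cases i <;> simp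
  have hline1 : ∀ b : ℝ,
      !₂[(0 : ℝ), b, (1 : ℝ)] = !₂[(0 : ℝ), (0 : ℝ), (1 : ℝ)] + b • EuclideanSpace.single (1 : Fin 3) (1 : ℝ) := by
    intro b; ext i; fin_cases i <;> simp
  have hconst : ∀ q : ℝ × ℝ, V !₂[q.1, q.2, (1 : ℝ)] = V !₂[(0 : ℝ), (0 : ℝ), (1 : ℝ)] := by
    intro q
    rw [hline0 q.1 q.2, const_on_line he0 (periodic_nat_mul _ hP0) hbd hVd _
      (by rw [hpt2]) (by rw [hpt2]; norm_num), hline1 q.2,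
      const_on_line he1 (periodic_nat_mul _ hP1) hbd hVd _ (by rw [hpt2]) (by rw [hpt2]; norm_num)]
  -- zero mass flux forces the vertical trace to vanish, hence zero energy flux
  simp_rw [hconst] at hmass hflux
  have hvol : (volume : Measure (ℝ × ℝ)).real (Set.Icc (0 : ℝ) 1 ×ˢ Set.Icc (0 : ℝ) 1) = 1 := by
    simp only [Measure.real]
    rw [Measure.volume_eq_prod, Measure.prod_prod, Real.volume_Icc]
    simp
  rw [setIntegral_const, hvol, one_smul] at hmass
  rw [hmass] at hflux
  simp at hflux
  exact hF hflux.symm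

end Summit.AnomalousDissipation.AnomalousDissipation.Theorems
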